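import Summits.BirchSwinnertonDyer.BirchSwinnertonDyer.Theorems.KimAtThreeDeepLowerOffStratumResidue
import Summits.BirchSwinnertonDyer.BirchSwinnertonDyer.Theorems.SignedSupersingularInputs
import Summits.BirchSwinnertonDyer.Rank1Residual.X11a.Cells
import Literature.NumberTheory.EllipticCurves.ZywinaCMImageProofs
import Literature.NumberTheory.EllipticCurves.NonEisensteinPrimeOfSurjective
import HarnessLib

/-!
# Route `KimAtThreeKolyvagin` (rung W2), crux `DeepLowerAtThreeOffKatoStratum` (item 19679), registered
# stub `stub_nonAdditive`: the two corner lower-half families SHARPENED to their census-measurable rows —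
# conductor `≥ 5000` (Miller 2011 closes `N < 5000`) and `3 ∣ #Ш_an` (the lower half is free when `3 ∤ #Ш_an`) —
# and keyed BY NAME to rung K3 / corner X11a at `3`, ROUTE-INDEPENDENTLY

Cell `bsd-addord`, seat `bsd-addord-w2-acc2` (PROGRAMME PART 1b, ACCEL-LIST row (2)), gen 3; item
`stmt-BirchSwinnertonDyer-19679`; sequel to `KimAtThreeDeepLowerOffStratumCornerKeys` (p473283: (L_ss) ⟸ rung
K3 leaf or K3 cruxes, (L_m) ⟸ corner X11a's `TargetThree`). THIS file imports no route file other than the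
crux's own (`…CornerKeys` imports `Theses.SignedLowerHalves` for the crux-keyed versions, so its importers
sit in that route's rebuild cone — gate lint `lint.theses-cone`); the owner's assembly should import THIS file.
Theorems only; nothing asserted; no `sorry`.

The two corner families displayed by the owner's assembly on the non-additive rows,
* (L_ss) «`∀ W` tower-surjective, analytic rank `0`, good at `3`, `3 ∣ a₃ ⟹ MissingLowerBoundAt W 3`»,
* (L_m)  «`∀ W` tower-surjective, analytic rank `0`, multiplicative at `3`, not semistable, no (ram) witness
  `⟹ MissingLowerBoundAt W 3`»,
have content only on the rows with `N_E ≥ 5000` AND `3 ∣ #Ш(E/ℚ)_an`: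
* §1 `lowerHalf_of_shaAnUnit` — if `#Ш_an` is a rational number of `3`-adic valuation `0` (the census bit
  `X11a.ShaAnUnit W 3`, decided curve by curve), Miller's lower half `ord₃ #Ш_an ≤ ord₃ #Ш` holds OUTRIGHT;
  §1 `lowerHalf_three_of_conductor_lt_of_miller` — on a tower-surjective row of analytic rank `≤ 1` with
  `N_E < 5000`, `BSD(E,3)` is Miller 2011 Thm. 1.2 (named fact `bsdp_of_irreducible_of_conductor_lt`, PUB,
  with Lawson–Wuthrich 2016 §5), hence the lower half;
* §2 `lowerHalf_goodSS_three_iff_sharp` / `lowerHalf_multNotRam_three_iff_sharp`: granted Miller 2011 and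
  GZK, (L_ss) ⟺ (L_ss♯) and (L_m) ⟺ (L_m♯), where ♯ adds the binders `5000 ≤ N_E`, `¬ X11a.ShaAnUnit W 3`;
* §3 the ♯ families BY NAME, route-independently: `sharpLss_of_signedSupersingular` ⟸ the rung-K3 CLOSED LEAF
  `Rank1Residual.Supersingular.SignedSupersingular` + Wuthrich 2014 Prop. 21 + GZK + modularity (a
  tower-surjective curve is non-CM — `not_hasSurjectiveModNGaloisRep_of_hasCM`, Zywina 2015 / Serre 1972, tree
  theorem — and a good-supersingular-`3` tower row of analytic rank `0` lies in X6 / X7 / X8 at `3`;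
  `Supersingular.bsdp_of_signedSupersingular`); `sharpLm_of_x11aTargetThree` ⟸ `Rank1Residual.X11a.TargetThree`
  (cell b2b-bsdres' statement of record for the `p = 3` sub-cell of corner X11a) + GZK;
* §4 ★★★★♯ `stub_nonAdditive_of_sharpCornerLowerHalves_of_tamagawa_le_deepInfty` — the registered stub
  VERBATIM from TEN named published facts + (L_ss♯) + (L_m♯) + (TD); ★★★★♯′
  `stub_nonAdditive_of_rungK3_of_x11aThree_sharp_of_tamagawa_le_deepInfty` — the same with the ♯ families
  discharged BY NAME (K3 leaf, `X11a.TargetThree`; + Wuthrich Prop. 21).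
READING for the census: the non-additive residual of crux 19679 is supported on {good-supersingular-`3`
∪ (multiplicative-`3`, non-semistable, no (ram))} ∩ {`r_an = 0`, tower-surjective, `N_E ≥ 5000`, `3 ∣ #Ш_an`}
(lower half; = rung K3 / corner X11a at `3` there) ∪ {`3 ∣ ∏ c_ℓ`} ((TD)). HONEST FRAMING: conditional;
closes nothing; rung K3 and corner X11a at `3` are OPEN; BSD is not proved by any of this; nothing is booked.

References: [Miller2011LMS] Thm. 1.2, Def. 1.1; [LawsonWuthrich2016] §5, Thm. 14, Prop. 15; [Wuthrich2014]
Prop. 21; [Zywina2015] Prop. 1.14/1.16; [Serre1972] §4.5; [YanZhu2024MainConjNonCM] Thm. 4.15;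
[Skinner2016PacificMC] Thm. C; [Kim2022StructureSelmer] Conj. 1.10.
-/

set_option autoImplicit false
-- the Theorems namespace of a single-conjunct summit repeats the summit name by design (D-0017)
set_option linter.dupNamespace false

noncomputable section

open scoped MatrixGroups ModularForm Classical

open CongruenceSubgroup WeierstrassCurve Literature.NumberTheory.EllipticCurves
  Literature.NumberTheory.EllipticCurves.ModularForms
  Literature.NumberTheory.EllipticCurves.Rank1Residual
  Literature.NumberTheory.EllipticCurves.Rank1Residual.Typed
  Literature.NumberTheory.EllipticCurves.Skinner2016
  Literature.NumberTheory.Automorphic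
  Summit.BirchSwinnertonDyer.BirchSwinnertonDyer.Theorems.Rank1ResidualX1Defs

namespace Summit.BirchSwinnertonDyer.BirchSwinnertonDyer.Theorems.KimAtThreeDeepLowerOffStratumCornerKeysSharp

open Summit.BirchSwinnertonDyer.Rank1Residual
open Summit.BirchSwinnertonDyer.BirchSwinnertonDyer.Theorems.KimAtThreeDeepLowerOffStratumResidue

/-! ### §1 The two free sub-rows: `3 ∤ #Ш_an`, and `N_E < 5000` -/

section Free

/-- **`3 ∤ #Ш_an ⟹` Miller's lower half, outright** (any curve, any prime): if `#Ш(E/ℚ)_an` is a rational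
number of `p`-adic valuation `0` (the census bit `X11a.ShaAnUnit W p`), then `ord_p #Ш_an = 0 ≤ ord_p #Ш`.
[cite: Miller2011LMS, Def. 1.1 (arXiv:1010.2431 p. 3)] -/
theorem lowerHalf_of_shaAnUnit (W : WeierstrassCurve ℚ) (p : ℕ) (h : X11a.ShaAnUnit W p) :
    MissingLowerBoundAt W p := by
  obtain ⟨q, hq, hv⟩ := h
  exact ⟨q, hq, by rw [hv]; exact_mod_cast Nat.zero_le _⟩

/-- **`N_E < 5000 ⟹` Miller's lower half at `3` on a tower-surjective row of analytic rank `≤ 1`** — Miller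
2011 Thm. 1.2 (named fact `hMi = bsdp_of_irreducible_of_conductor_lt`, PUB, with Lawson–Wuthrich 2016 §5:
`BSD(E,p)` for `N_E < 5000`, `r_an ≤ 1`, `E[p]` irreducible) and GZK (`Ш` finite).
[cite: Miller2011LMS, Thm. 1.2] [cite: LawsonWuthrich2016, §5, Thm. 14 and Prop. 15] -/
theorem lowerHalf_three_of_conductor_lt_of_miller (hMi : bsdp_of_irreducible_of_conductor_lt)
    (hGZK : rank_eq_analyticRank_of_analyticRank_le_one)
    (W : WeierstrassCurve ℚ) [W.IsElliptic] [W.IsGloballyMinimal]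
    (htower : ∀ n : ℕ, W.HasSurjectiveModNGaloisRep (3 ^ n : ℕ)) (hr : W.analyticRank ≤ 1)
    (hN : W.conductorNorm ℤ < 5000) : MissingLowerBoundAt W 3 := by
  haveI : Fact (Nat.Prime 3) := ⟨Nat.prime_three⟩
  have hirr : W.HasIrreducibleModPGaloisRep 3 :=
    hasIrreducibleModPGaloisRep_of_hasSurjectiveModNGaloisRep W 3 (by simpa using htower 1)
  haveI : Finite W.sha := (hGZK W hr).2
  exact (lower_and_upper_of_missingPPartAt W 3 (missingPPartAt_of_bsdp W 3
    (hMi W hr hN 3 Nat.prime_three hirr))).1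

end Free

/-! ### §2 (L_ss) ⟺ (L_ss♯), (L_m) ⟺ (L_m♯) -/

section Sharp

/-- **(L_ss) ⟺ (L_ss♯)**: granted Miller 2011 (`hMi`) and GZK, the good-supersingular-`3` lower-half family
of crux 19679 has content only on the rows with `N_E ≥ 5000` and `3 ∣ #Ш_an` (`¬ X11a.ShaAnUnit W 3`).
[cite: Miller2011LMS, Thm. 1.2, Def. 1.1] -/
theorem lowerHalf_goodSS_three_iff_sharp (hMi : bsdp_of_irreducible_of_conductor_lt)
    (hGZK : rank_eq_analyticRank_of_analyticRank_le_one) :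
    (∀ (W : WeierstrassCurve ℚ) [W.IsElliptic] [W.IsGloballyMinimal],
      (∀ n : ℕ, W.HasSurjectiveModNGaloisRep (3 ^ n : ℕ)) → W.analyticRank = 0 →
      W.HasGoodReductionAtPrime 3 → (3 : ℤ) ∣ W.frobeniusTrace 3 → MissingLowerBoundAt W 3) ↔
    (∀ (W : WeierstrassCurve ℚ) [W.IsElliptic] [W.IsGloballyMinimal],
      (∀ n : ℕ, W.HasSurjectiveModNGaloisRep (3 ^ n : ℕ)) → W.analyticRank = 0 →
      W.HasGoodReductionAtPrime 3 → (3 : ℤ) ∣ W.frobeniusTrace 3 →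
      5000 ≤ W.conductorNorm ℤ → ¬ X11a.ShaAnUnit W 3 → MissingLowerBoundAt W 3) := by
  refine ⟨fun h W _ _ htower hr0 hgood hss _ _ ↦ h W htower hr0 hgood hss, fun h W _ _ htower hr0 hgood hss ↦ ?_⟩
  by_cases hu : X11a.ShaAnUnit W 3
  · exact lowerHalf_of_shaAnUnit W 3 hu
  by_cases hN : W.conductorNorm ℤ < 5000
  · exact lowerHalf_three_of_conductor_lt_of_miller hMi hGZK W htower (by omega) hN
  · exact h W htower hr0 hgood hss (by omega) hu

/-- **(L_m) ⟺ (L_m♯)**: granted Miller 2011 (`hMi`) and GZK, the multiplicative-`3` non-semistable (ram)-free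
lower-half family of crux 19679 has content only on the rows with `N_E ≥ 5000` and `3 ∣ #Ш_an`.
[cite: Miller2011LMS, Thm. 1.2, Def. 1.1] -/
theorem lowerHalf_multNotRam_three_iff_sharp (hMi : bsdp_of_irreducible_of_conductor_lt)
    (hGZK : rank_eq_analyticRank_of_analyticRank_le_one) :
    (∀ (W : WeierstrassCurve ℚ) [W.IsElliptic] [W.IsGloballyMinimal],
      (∀ n : ℕ, W.HasSurjectiveModNGaloisRep (3 ^ n : ℕ)) → W.analyticRank = 0 →
      W.HasMultiplicativeReductionAtPrime 3 → ¬ Semistable W →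
      ¬ (haveI : Fact (Nat.Prime 3) := ⟨Nat.prime_three⟩; Ram W 3) → MissingLowerBoundAt W 3) ↔
    (∀ (W : WeierstrassCurve ℚ) [W.IsElliptic] [W.IsGloballyMinimal],
      (∀ n : ℕ, W.HasSurjectiveModNGaloisRep (3 ^ n : ℕ)) → W.analyticRank = 0 →
      W.HasMultiplicativeReductionAtPrime 3 → ¬ Semistable W →
      ¬ (haveI : Fact (Nat.Prime 3) := ⟨Nat.prime_three⟩; Ram W 3) →
      5000 ≤ W.conductorNorm ℤ → ¬ X11a.ShaAnUnit W 3 → MissingLowerBoundAt W 3) := by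
  refine ⟨fun h W _ _ htower hr0 hmult hsst hram _ _ ↦ h W htower hr0 hmult hsst hram,
    fun h W _ _ htower hr0 hmult hsst hram ↦ ?_⟩
  by_cases hu : X11a.ShaAnUnit W 3
  · exact lowerHalf_of_shaAnUnit W 3 hu
  by_cases hN : W.conductorNorm ℤ < 5000
  · exact lowerHalf_three_of_conductor_lt_of_miller hMi hGZK W htower (by omega) hN
  · exact h W htower hr0 hmult hsst hram (by omega) hu

end Sharp

/-! ### §3 The ♯ families BY NAME, route-independently: rung K3, corner X11a at `3` -/

section Keys

/-- **(L_ss♯) ⟸ the rung-K3 closed leaf `SignedSupersingular`** (+ Wuthrich 2014 Prop. 21 `hW`, GZK `hGZK`,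
modularity `hmod`), route-independently (the ♯ binders `5000 ≤ N_E`, `3 ∣ #Ш_an` are not even used: the leaf
covers every good-supersingular-`3` tower row of analytic rank `0`). The curve is non-CM
(`not_hasSurjectiveModNGaloisRep_of_hasCM`), the pair lies in X6 (`a₃ = 0`, semistable), X7 (`a₃ = 0`, not
semistable) or X8 (`a₃ ≠ 0`), `Supersingular.bsdp_of_signedSupersingular` gives `BSD(E,3)`, and
`missingPPartAt_of_bsdp` the lower half. CONDITIONAL on the leaf (OPEN).
[cite: Wuthrich2014, Prop. 21 (p. 400)] [cite: Zywina2015, Prop. 1.14 and Prop. 1.16 (§1.9)]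
[cite: Miller2011LMS, Def. 1.1] -/
theorem sharpLss_of_signedSupersingular
    (hK3 : Supersingular.SignedSupersingular) (hW : Wuthrich2014.sha_dvd_analyticSha)
    (hGZK : rank_eq_analyticRank_of_analyticRank_le_one) (hmod : hasEntireLFunction_rat) :
    ∀ (W : WeierstrassCurve ℚ) [W.IsElliptic] [W.IsGloballyMinimal],
      (∀ n : ℕ, W.HasSurjectiveModNGaloisRep (3 ^ n : ℕ)) → W.analyticRank = 0 →
      W.HasGoodReductionAtPrime 3 → (3 : ℤ) ∣ W.frobeniusTrace 3 →
      5000 ≤ W.conductorNorm ℤ → ¬ X11a.ShaAnUnit W 3 → MissingLowerBoundAt W 3 := by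
  intro W _ _ htower hr0 hgood hss _ _
  haveI : Fact (Nat.Prime 3) := ⟨Nat.prime_three⟩
  have hsurj : Surj W 3 := by simpa [Surj] using htower 1
  have hcm : ¬ W.HasCM := fun hCM ↦
    W.not_hasSurjectiveModNGaloisRep_of_hasCM hCM Nat.prime_three (by decide) hsurj
  have hr : W.analyticRank ≤ 1 := by omega
  haveI : Finite W.sha := (hGZK W hr).2
  obtain ⟨h6, h7, h8⟩ :=
    Supersingular.bsdp_of_signedSupersingular (W := W) (p := 3) hK3 hW hGZK hmod hr hcm (by decide)
  have hGS : GoodSS W 3 := ⟨hgood, hss⟩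
  have hbsd : BSDp W 3 := by
    by_cases ha : W.frobeniusTrace 3 = 0
    · by_cases hsst : Semistable W
      · exact h6 ⟨hGS, hsst, Or.inr ha⟩ hr0
      · exact h7 ⟨hGS, hsst⟩
    · exact h8 ⟨rfl, hGS, ha⟩
  exact (lower_and_upper_of_missingPPartAt W 3 (missingPPartAt_of_bsdp W 3 hbsd)).1

/-- **(L_m♯) ⟸ corner X11a's `p = 3` sub-cell target `X11a.TargetThree`** (cell b2b-bsdres' statement of
record: `BSD(E,3)` on every `CellThree` pair; OPEN) + GZK, route-independently. An (L_m) row IS a `CellThree`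
pair (tower-surjective ⟹ `E[3]` irreducible; `r_an = 0`, multiplicative `3`, no (ram), `3 ≠ 2`).
[cite: Miller2011LMS, Def. 1.1] [cite: Wuthrich2014, Prop. 21 (p. 400)] -/
theorem sharpLm_of_x11aTargetThree (hT3 : X11a.TargetThree)
    (hGZK : rank_eq_analyticRank_of_analyticRank_le_one) :
    ∀ (W : WeierstrassCurve ℚ) [W.IsElliptic] [W.IsGloballyMinimal],
      (∀ n : ℕ, W.HasSurjectiveModNGaloisRep (3 ^ n : ℕ)) → W.analyticRank = 0 →
      W.HasMultiplicativeReductionAtPrime 3 → ¬ Semistable W →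
      ¬ (haveI : Fact (Nat.Prime 3) := ⟨Nat.prime_three⟩; Ram W 3) →
      5000 ≤ W.conductorNorm ℤ → ¬ X11a.ShaAnUnit W 3 → MissingLowerBoundAt W 3 := by
  intro W _ _ htower hr0 hmult _ hram _ _
  haveI : Fact (Nat.Prime 3) := ⟨Nat.prime_three⟩
  have hirr : W.HasIrreducibleModPGaloisRep 3 :=
    hasIrreducibleModPGaloisRep_of_hasSurjectiveModNGaloisRep W 3 (by simpa using htower 1)
  haveI : Finite W.sha := (hGZK W (by omega)).2
  exact (lower_and_upper_of_missingPPartAt W 3 (missingPPartAt_of_bsdp W 3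
    (hT3 W 3 ⟨⟨hr0, by decide, hmult, hirr, hram⟩, rfl⟩))).1

end Keys

/-! ### §4 The registered stub VERBATIM from the ♯ families -/

section Stub

/-- ★★★★♯ **The registered stub `stub_nonAdditive` of crux 19679, VERBATIM, from TEN named published facts
and the two SHARPENED corner families + (TD).** Named facts: Yan–Zhu 2026 Thm. 4.15 (`hYZ`, PUB*), Wuthrich
2014 Lemma 20 (`hW20`), Skinner 2016 Thm. C (`hSk`), modularity (`hmod`, `hBCDT`), GZK (`hGZK`), Mazur 1978
Cor. 4.1 (`hM`), Ribet 1990 / Diamond 1995 (`hLL`), Miller 2011 Thm. 1.2 (`hMi`). Displayed: (L_ss♯) the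
lower half on good-supersingular-`3` tower rows of analytic rank `0` with `N_E ≥ 5000` and `3 ∣ #Ш_an`
(rung K3 there); (L_m♯) the same on non-semistable multiplicative-`3` (ram)-free tower rows of analytic rank
`0` with `N_E ≥ 5000` and `3 ∣ #Ш_an` (corner X11a at `3` there); (TD) TamDiv-deep on the `3 ∣ ∏ c_ℓ` rows.
CONDITIONAL; does not close the item. [cite: Miller2011LMS, Thm. 1.2, Def. 1.1]
[cite: YanZhu2024MainConjNonCM, Thm. 4.15 (§4.6)] [cite: Skinner2016PacificMC, Thm. C (§1)]
[cite: Wuthrich2014, Lemma 20 (p. 399)] [cite: Ribet1990, Thm. 1.1] [cite: Mazur1978, Cor. 4.1]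
[cite: Kim2022StructureSelmer, Conj. 1.10 (PDF p. 8)] -/
theorem stub_nonAdditive_of_sharpCornerLowerHalves_of_tamagawa_le_deepInfty
    (hYZ : YanZhu2026.thm415_padicValRat_bsd_rank_le_one)
    (hW20 : Wuthrich2014.lemma20_surjective_threeAdic_of_semistable)
    (hSk : Skinner2016.thmC_padicValRat_bsd_rank_zero)
    (hmod : hasEntireLFunction_rat) (hGZK : rank_eq_analyticRank_of_analyticRank_le_one)
    (hM : mazur_not_dvd_maninConstant_of_odd)
    (hBCDT : exists_isNewformOf) (hLL : diamond1995_refinedSerre)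
    (hMi : bsdp_of_irreducible_of_conductor_lt)
    (hLss' : ∀ (W : WeierstrassCurve ℚ) [W.IsElliptic] [W.IsGloballyMinimal],
      (∀ n : ℕ, W.HasSurjectiveModNGaloisRep (3 ^ n : ℕ)) → W.analyticRank = 0 →
      W.HasGoodReductionAtPrime 3 → (3 : ℤ) ∣ W.frobeniusTrace 3 →
      5000 ≤ W.conductorNorm ℤ → ¬ X11a.ShaAnUnit W 3 → MissingLowerBoundAt W 3)
    (hLm' : ∀ (W : WeierstrassCurve ℚ) [W.IsElliptic] [W.IsGloballyMinimal],
      (∀ n : ℕ, W.HasSurjectiveModNGaloisRep (3 ^ n : ℕ)) → W.analyticRank = 0 →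
      W.HasMultiplicativeReductionAtPrime 3 → ¬ Semistable W →
      ¬ (haveI : Fact (Nat.Prime 3) := ⟨Nat.prime_three⟩; Ram W 3) →
      5000 ≤ W.conductorNorm ℤ → ¬ X11a.ShaAnUnit W 3 → MissingLowerBoundAt W 3)
    (hTD : ∀ (W : WeierstrassCurve ℚ) [W.IsElliptic] [W.IsGloballyMinimal],
      (∀ n : ℕ, W.HasSurjectiveModNGaloisRep (3 ^ n : ℕ)) →
      ∀ {N : ℕ} [NeZero N] (f : CuspForm (Gamma0 N) 2), IsNewformOf W f →
      kuriharaVanishingOrder W 3 f = 0 →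
      ¬ (haveI : Fact (Nat.Prime 3) := ⟨Nat.prime_three⟩; Addv W 3) → 3 ∣ W.tamagawaProduct →
        ((padicValNat 3 W.tamagawaProduct : ℕ) : ℕ∞) ≤ kuriharaPartialDeepInfty W 3 f) :
    ∀ (W₀ : WeierstrassCurve ℚ) [W₀.IsElliptic] [W₀.IsGloballyMinimal],
      (∀ n : ℕ, W₀.HasSurjectiveModNGaloisRep (3 ^ n : ℕ)) → Finite W₀.sha →
      ∀ {N : ℕ} [NeZero N], N = W₀.conductorNorm ℤ →
      ∀ (D₀ : ModularParametrizationData W₀ N),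
        (∀ z ∈ D₀.L.lattice, ∃ w ∈ periodLattice D₀.f, z = D₀.c * w) →
        (∀ (W₂ : WeierstrassCurve ℚ) [W₂.IsElliptic] (D₂ : ModularParametrizationData W₂ N),
          D₂.f = D₀.f → D₀.modularDegree ≤ D₂.modularDegree) →
        (∀ r : ℚ, ratPlusSymbol D₀.f r ≠ 0 → 0 ≤ padicValRat 3 (ratPlusSymbol D₀.f r)) →
        kuriharaVanishingOrder W₀ 3 D₀.f = 0 →
        ¬ (haveI : Fact (Nat.Prime 3) := ⟨Nat.prime_three⟩; Addv W₀ 3) →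
        ∃ d : ℕ, kuriharaPartialDeepInfty W₀ 3 D₀.f = d ∧
          kuriharaPartial W₀ 3 D₀.f 0 ≤
            ((padicValNat 3 (Nat.card (AddCommGroup.primaryComponent W₀.sha 3)) + d : ℕ) : ℕ∞) :=
  stub_nonAdditive_of_cornerLowerHalves_of_tamagawa_le_deepInfty hYZ hW20 hSk hmod hGZK hM hBCDT hLL
    ((lowerHalf_goodSS_three_iff_sharp hMi hGZK).2 hLss')
    ((lowerHalf_multNotRam_three_iff_sharp hMi hGZK).2 hLm') hTD

/-- ★★★★♯′ **The registered stub VERBATIM, route-independently, from ELEVEN named published facts, the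
rung-K3 leaf, corner X11a's `p = 3` target, and (TD)** — ★★★★♯ with (L_ss♯) ⟸ `SignedSupersingular`
(+ Wuthrich Prop. 21 `hW`) and (L_m♯) ⟸ `X11a.TargetThree` (§3). CONDITIONAL; does not close the item.
[cite: Miller2011LMS, Thm. 1.2, Def. 1.1] [cite: Wuthrich2014, Prop. 21 (p. 400)]
[cite: YanZhu2024MainConjNonCM, Thm. 4.15 (§4.6)] [cite: Skinner2016PacificMC, Thm. C (§1)]
[cite: Ribet1990, Thm. 1.1] [cite: Mazur1978, Cor. 4.1] [cite: Kim2022StructureSelmer, Conj. 1.10 (PDF p. 8)] -/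
theorem stub_nonAdditive_of_rungK3_of_x11aThree_sharp_of_tamagawa_le_deepInfty
    (hYZ : YanZhu2026.thm415_padicValRat_bsd_rank_le_one)
    (hW20 : Wuthrich2014.lemma20_surjective_threeAdic_of_semistable)
    (hW : Wuthrich2014.sha_dvd_analyticSha)
    (hSk : Skinner2016.thmC_padicValRat_bsd_rank_zero)
    (hmod : hasEntireLFunction_rat) (hGZK : rank_eq_analyticRank_of_analyticRank_le_one)
    (hM : mazur_not_dvd_maninConstant_of_odd)
    (hBCDT : exists_isNewformOf) (hLL : diamond1995_refinedSerre)
    (hMi : bsdp_of_irreducible_of_conductor_lt)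
    (hK3 : Supersingular.SignedSupersingular) (hT3 : X11a.TargetThree)
    (hTD : ∀ (W : WeierstrassCurve ℚ) [W.IsElliptic] [W.IsGloballyMinimal],
      (∀ n : ℕ, W.HasSurjectiveModNGaloisRep (3 ^ n : ℕ)) →
      ∀ {N : ℕ} [NeZero N] (f : CuspForm (Gamma0 N) 2), IsNewformOf W f →
      kuriharaVanishingOrder W 3 f = 0 →
      ¬ (haveI : Fact (Nat.Prime 3) := ⟨Nat.prime_three⟩; Addv W 3) → 3 ∣ W.tamagawaProduct →
        ((padicValNat 3 W.tamagawaProduct : ℕ) : ℕ∞) ≤ kuriharaPartialDeepInfty W 3 f) :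
    ∀ (W₀ : WeierstrassCurve ℚ) [W₀.IsElliptic] [W₀.IsGloballyMinimal],
      (∀ n : ℕ, W₀.HasSurjectiveModNGaloisRep (3 ^ n : ℕ)) → Finite W₀.sha →
      ∀ {N : ℕ} [NeZero N], N = W₀.conductorNorm ℤ →
      ∀ (D₀ : ModularParametrizationData W₀ N),
        (∀ z ∈ D₀.L.lattice, ∃ w ∈ periodLattice D₀.f, z = D₀.c * w) →
        (∀ (W₂ : WeierstrassCurve ℚ) [W₂.IsElliptic] (D₂ : ModularParametrizationData W₂ N),
          D₂.f = D₀.f → D₀.modularDegree ≤ D₂.modularDegree) →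
        (∀ r : ℚ, ratPlusSymbol D₀.f r ≠ 0 → 0 ≤ padicValRat 3 (ratPlusSymbol D₀.f r)) →
        kuriharaVanishingOrder W₀ 3 D₀.f = 0 →
        ¬ (haveI : Fact (Nat.Prime 3) := ⟨Nat.prime_three⟩; Addv W₀ 3) →
        ∃ d : ℕ, kuriharaPartialDeepInfty W₀ 3 D₀.f = d ∧
          kuriharaPartial W₀ 3 D₀.f 0 ≤
            ((padicValNat 3 (Nat.card (AddCommGroup.primaryComponent W₀.sha 3)) + d : ℕ) : ℕ∞) :=
  stub_nonAdditive_of_sharpCornerLowerHalves_of_tamagawa_le_deepInfty hYZ hW20 hSk hmod hGZK hM hBCDT hLL hMi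
    (sharpLss_of_signedSupersingular hK3 hW hGZK hmod) (sharpLm_of_x11aTargetThree hT3 hGZK) hTD

end Stub

end Summit.BirchSwinnertonDyer.BirchSwinnertonDyer.Theorems.KimAtThreeDeepLowerOffStratumCornerKeysSharp

end
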